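import Literature.Probability.RandomPlanarGeometry.SAWPulledLargeForceExpansionZdWordTypesSeven
import HarnessLib

/-!
# Axis types of any length by a pruned depth-first search: the census framework «ZD-WORD-SEARCH», and the kernel cell of the ten-step census

Topic `Literature/Probability/RandomPlanarGeometry` (continuation of `…ZdWordTypes` / `…ZdWordTypesSix` / `…ZdWordTypesSeven`: the
master formula `WordTypes.card_filter_eq_sum_transversal` turns every type-invariant count of transverse step words of `ℤ^{d+1}` into a
polynomial in `d` once the canonical words (the transversal) are censused; at length 7 that census ran over a 645 120-tuple box cut by
restricted growth.  Here the transversal of ANY length `L` is the abstract `TL L = {τ : Word L L | canon τ = τ}` — COMPLETENESS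
`canon_mem_TL`, total size `count_TL : Σ_τ d^{(k(τ))} = (2d)^L`, master formula `card_filter_eq_sum_TL` — and the census is a PRUNED
DEPTH-FIRST SEARCH that writes only canonical words (restricted growth, letter by letter: `rgOK`, `naxL`, ★ `growthOK_iff_rgOK`,
★ `numAxes_eq_naxL`), under a letter policy `alw` (`alwAll`: every letter; `alwR`: a new axis positive only), discards a prefix as soon
as a state test `ok` fails (for self-avoiding words: its endpoint revisits an earlier point), and at full length records the classes
`cls c` that hold.  The search value `dfsV` is ONE natural number encoding the table class × number-of-axes in base `B` (★ `dfsV_eq`);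
its digits are the scalar counts `dfsN` (a-priori bound ★ `dfsN_le`, read-off ★★ `dfsN_eq_of_table`), and ★★ `dfsN_eq_card` /
★★ `card_TL_class` identify them with the class counts over the transversal; ★★★ `card_eq_sum_dfsN` is the census in every dimension
`d`.  The last section sets up the state for step-word censuses (reversed raw prefix, backward displacements: `okR`, `unitR`, `clsR8`)
and evaluates ★ `dfsV_eight_reduced`, the kernel cell of the ten-step census «ZD-TEN-STEP» (the 25 772 canonical self-avoiding
eight-letter words with positive first occurrences, by class and number of axes) — whose reading in every dimension (the closer
censuses of the nine-step self-avoiding walks and `c₉(ℤ^d)`) is the sequel's.  [cite: MadrasSlade1993, Definition 1.2.4]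
The definitions `rawW`, `nxt`, `rgOK`, `naxL`, `rgA`, `alwAll`, `pmN`, `lts`, `st`, `leafV`, `dfsV`, `dfsN`, `rowV`, `xw`, `Adm`, `TL`, `PrefixOK`,
`sgZ`, `addD`, `isZ`, `retZ`, `updR`, `okR`, `sumD`, `isUnit`, `unitR`, `clsR8`, `alwR` are this file's tool notions (not notions in print).  No number is taken from print.

Provenance: lane «pcv-sawmu», a-p3 g20 (2026-08-26); the cell value is reproduced by the seat's enumerator `types8.py` / `table8red.json`
(reduced canonical words of length 8; doubling each axis count `k` by `2^k` gives the full type counts 2, 2956, 61704, 184576, 158304,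
50304, 6272, 256 of the eight-step self-avoiding walks, i.e. `c₈(ℤ^d)` of `…ZdNineStep` by a third route).
-/

open Finset
open scoped BigOperators
open Literature.Probability.LatticeModels
open Literature.Probability.RandomPlanarGeometry.SAW

namespace Literature.Probability.RandomPlanarGeometry.SAW.Zd

namespace WordTypes

/-! ### Raw words and restricted growth, recursively -/

section rawgrowth

variable {L n : ℕ}

/-- The raw form of a word: its letters as `(axis, sign) : ℕ × Bool`, in order. [cite: MadrasSlade1993, Definition 1.2.4] -/
def rawW (τ : Word L n) : List (ℕ × Bool) := List.ofFn fun p => raw (τ p)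

/-- The axis count after one more raw letter: `max m (axis + 1)`. [cite: MadrasSlade1993, Definition 1.2.4] -/
def nxt (m : ℕ) (a : ℕ × Bool) : ℕ := m ⊔ (a.1 + 1)

/-- Running restricted growth of a raw word read from axis count `m`: every letter has axis `≤` the running count. [cite: MadrasSlade1993, Definition 1.2.4] -/
def rgOK : ℕ → List (ℕ × Bool) → Bool
  | _, [] => true
  | m, a :: w => Nat.ble a.1 m && rgOK (nxt m a) w

/-- The running axis count after a raw word read from axis count `m`. [cite: MadrasSlade1993, Definition 1.2.4] -/
def naxL : ℕ → List (ℕ × Bool) → ℕ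
  | m, [] => m
  | m, a :: w => naxL (nxt m a) w

/-- `rgOK` of a concatenation. [cite: MadrasSlade1993, Definition 1.2.4] -/
theorem rgOK_append (m : ℕ) (w₁ w₂ : List (ℕ × Bool)) : rgOK m (w₁ ++ w₂) = (rgOK m w₁ && rgOK (naxL m w₁) w₂) := by
  induction w₁ generalizing m with
  | nil => simp [rgOK, naxL]
  | cons a w ih => simp [rgOK, naxL, ih, Bool.and_assoc]

/-- `naxL` of a concatenation. [cite: MadrasSlade1993, Definition 1.2.4] -/
theorem naxL_append (m : ℕ) (w₁ w₂ : List (ℕ × Bool)) : naxL m (w₁ ++ w₂) = naxL (naxL m w₁) w₂ := by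
  induction w₁ generalizing m with
  | nil => rfl
  | cons a w ih => exact ih _

/-- `rgOK` after one more letter at the end. [cite: MadrasSlade1993, Definition 1.2.4] -/
theorem rgOK_append_singleton (m : ℕ) (w : List (ℕ × Bool)) (a : ℕ × Bool) :
    rgOK m (w ++ [a]) = (rgOK m w && Nat.ble a.1 (naxL m w)) := by
  rw [rgOK_append]; simp [rgOK]

/-- `naxL` after one more letter at the end. [cite: MadrasSlade1993, Definition 1.2.4] -/
theorem naxL_append_singleton (m : ℕ) (w : List (ℕ × Bool)) (a : ℕ × Bool) : naxL m (w ++ [a]) = nxt (naxL m w) a := by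
  rw [naxL_append]; rfl

/-- `m ≤ naxL m w`. [cite: MadrasSlade1993, Definition 1.2.4] -/
theorem le_naxL (m : ℕ) (w : List (ℕ × Bool)) : m ≤ naxL m w := by
  induction w generalizing m with
  | nil => exact le_rfl
  | cons a w ih => exact le_trans (le_max_left _ _) (ih _)

/-- Under restricted growth the axis count grows by at most one per letter: `naxL m w ≤ m + |w|`. [cite: MadrasSlade1993, Definition 1.2.4] -/
theorem naxL_le (m : ℕ) (w : List (ℕ × Bool)) (h : rgOK m w = true) : naxL m w ≤ m + w.length := by
  induction w generalizing m with
  | nil => simp [naxL]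
  | cons a w ih =>
    simp only [rgOK, Bool.and_eq_true, Nat.ble_eq] at h
    have h1 : nxt m a ≤ m + 1 := max_le (Nat.le_succ m) (Nat.succ_le_succ h.1)
    calc naxL m (a :: w) = naxL (nxt m a) w := rfl
      _ ≤ nxt m a + w.length := ih _ h.2
      _ ≤ m + (a :: w).length := by simp only [List.length_cons]; omega

/-- Restricted growth under a LETTER POLICY `alw m a` (which letters may be written while the running axis count is `m`; the
search generates exactly these). [cite: MadrasSlade1993, Definition 1.2.4] -/
def rgA (alw : ℕ → ℕ × Bool → Bool) : ℕ → List (ℕ × Bool) → Bool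
  | _, [] => true
  | m, a :: w => (Nat.ble a.1 m && alw m a) && rgA alw (nxt m a) w

/-- `rgA` of a concatenation. [cite: MadrasSlade1993, Definition 1.2.4] -/
theorem rgA_append (alw : ℕ → ℕ × Bool → Bool) (m : ℕ) (w₁ w₂ : List (ℕ × Bool)) :
    rgA alw m (w₁ ++ w₂) = (rgA alw m w₁ && rgA alw (naxL m w₁) w₂) := by
  induction w₁ generalizing m with
  | nil => simp [rgA, naxL]
  | cons a w ih => simp [rgA, naxL, ih, Bool.and_assoc]

/-- `rgA` after one more letter at the end. [cite: MadrasSlade1993, Definition 1.2.4] -/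
theorem rgA_append_singleton (alw : ℕ → ℕ × Bool → Bool) (m : ℕ) (w : List (ℕ × Bool)) (a : ℕ × Bool) :
    rgA alw m (w ++ [a]) = (rgA alw m w && (Nat.ble a.1 (naxL m w) && alw (naxL m w) a)) := by
  rw [rgA_append]; simp [rgA]

/-- A policy-admissible word has restricted growth. [cite: MadrasSlade1993, Definition 1.2.4] -/
theorem rgOK_of_rgA (alw : ℕ → ℕ × Bool → Bool) : ∀ (m : ℕ) (w : List (ℕ × Bool)), rgA alw m w = true → rgOK m w = true := by
  intro m w
  induction w generalizing m with
  | nil => intro; rfl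
  | cons a w ih =>
    simp only [rgA, rgOK, Bool.and_eq_true]
    exact fun h => ⟨h.1.1, ih _ h.2⟩

/-- The policy allowing every letter. [cite: MadrasSlade1993, Definition 1.2.4] -/
def alwAll : ℕ → ℕ × Bool → Bool := fun _ _ => true

/-- Under the all-allowing policy, `rgA` is restricted growth. [cite: MadrasSlade1993, Definition 1.2.4] -/
theorem rgA_alwAll : ∀ (m : ℕ) (w : List (ℕ × Bool)), rgA alwAll m w = rgOK m w := by
  intro m w
  induction w generalizing m with
  | nil => rfl
  | cons a w ih => simp [rgA, rgOK, alwAll, ih]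

/-- The raw word has length `L`. [cite: MadrasSlade1993, Definition 1.2.4] -/
@[simp] theorem length_rawW (τ : Word L n) : (rawW τ).length = L := by simp [rawW]

/-- The prefix maxima of a word as a function of a natural position: `pmN τ j = max_{q < j} (axis (τ q) + 1)`. [cite: MadrasSlade1993, Definition 1.2.4] -/
def pmN (τ : Word L n) (j : ℕ) : ℕ := (Finset.univ.filter fun q : Fin L => q.val < j).sup fun q => (τ q).1.val + 1

/-- `pm` is `pmN` at `p.val`. [cite: MadrasSlade1993, Definition 1.2.4] -/
theorem pm_eq_pmN (τ : Word L n) (p : Fin L) : pm τ p = pmN τ p.val := by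
  unfold pm pmN
  congr 1

/-- `pmN` one position further. [cite: MadrasSlade1993, Definition 1.2.4] -/
theorem pmN_succ (τ : Word L n) (j : ℕ) (hj : j < L) : pmN τ (j + 1) = pmN τ j ⊔ ((τ ⟨j, hj⟩).1.val + 1) := by
  unfold pmN
  have : (Finset.univ.filter fun q : Fin L => q.val < j + 1) = insert ⟨j, hj⟩ (Finset.univ.filter fun q : Fin L => q.val < j) := by
    ext q
    simp only [Finset.mem_filter, Finset.mem_univ, true_and, Finset.mem_insert, Fin.ext_iff]
    omega
  rw [this, Finset.sup_insert, max_comm]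

/-- `pmN τ 0 = 0`. [cite: MadrasSlade1993, Definition 1.2.4] -/
theorem pmN_zero (τ : Word L n) : pmN τ 0 = 0 := by
  unfold pmN
  rw [Finset.filter_eq_empty_iff.2 (fun q _ => Nat.not_lt_zero _)]
  rfl

/-- The first `j` raw letters. [cite: MadrasSlade1993, Definition 1.2.4] -/
theorem rawW_take_succ (τ : Word L n) (j : ℕ) (hj : j < L) :
    (rawW τ).take (j + 1) = (rawW τ).take j ++ [raw (τ ⟨j, hj⟩)] := by
  rw [rawW, List.take_add_one, List.getElem?_ofFn]
  simp [hj]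

/-- ★ The recursive reading of restricted growth: after the first `j` letters, `rgOK` says `axis ≤ prefix max` at every position `< j` and
`naxL` is the prefix max `pmN τ j`. [cite: MadrasSlade1993, Definition 1.2.4] -/
theorem rgOK_naxL_take (τ : Word L n) (j : ℕ) (hj : j ≤ L) :
    (rgOK 0 ((rawW τ).take j) = true ↔ ∀ q : Fin L, q.val < j → (τ q).1.val ≤ pmN τ q.val) ∧ naxL 0 ((rawW τ).take j) = pmN τ j := by
  induction j with
  | zero =>
    simp [rgOK, naxL, pmN_zero]
  | succ j ih =>
    have hjL : j < L := Nat.lt_of_succ_le hj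
    obtain ⟨ih1, ih2⟩ := ih hjL.le
    rw [rawW_take_succ τ j hjL, rgOK_append_singleton, naxL_append_singleton, ih2, Bool.and_eq_true, ih1, Nat.ble_eq]
    refine ⟨?_, ?_⟩
    · constructor
      · rintro ⟨h1, h2⟩ q hq
        rcases Nat.lt_succ_iff_lt_or_eq.1 hq with hq' | hq'
        · exact h1 q hq'
        · have : q = ⟨j, hjL⟩ := Fin.ext hq'
          subst this
          exact h2
      · intro h
        exact ⟨fun q hq => h q (Nat.lt_succ_of_lt hq), h ⟨j, hjL⟩ (Nat.lt_succ_self j)⟩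
    · rw [pmN_succ τ j hjL]
      rfl

/-- ★ Restricted growth of a word = `rgOK` of its raw form. [cite: MadrasSlade1993, Definition 1.2.4] -/
theorem growthOK_iff_rgOK (τ : Word L n) : GrowthOK τ ↔ rgOK 0 (rawW τ) = true := by
  have h := (rgOK_naxL_take τ L le_rfl).1
  rw [List.take_of_length_le (by simp)] at h
  rw [h]
  unfold GrowthOK
  simp only [pm_eq_pmN]
  exact ⟨fun H q _ => H q, fun H q => H q q.isLt⟩

/-- ★ For a canonical (axis-fixed) word, `naxL` of the raw form is the number of axes. [cite: MadrasSlade1993, Definition 1.2.4] -/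
theorem numAxes_eq_naxL (τ : Word L n) (h : AxFixed τ) : numAxes τ = naxL 0 (rawW τ) := by
  rcases Nat.eq_zero_or_pos L with hL | hL
  · subst hL
    have : rawW τ = [] := by simp [rawW]
    rw [this, naxL]
    unfold numAxes firsts
    simp
  · have h2 := (rgOK_naxL_take τ L le_rfl).2
    rw [List.take_of_length_le (by simp)] at h2
    rw [h2, numAxes_eq_sup_succ τ h hL]
    unfold pmN
    rw [Finset.filter_true_of_mem fun q _ => q.isLt]
    -- `sup (f + 1) = sup f + 1` on a nonempty set
    obtain ⟨p, hp⟩ : ∃ p : Fin L, ∀ q : Fin L, (τ q).1.val ≤ (τ p).1.val :=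
      Finset.exists_max_image Finset.univ (fun q : Fin L => (τ q).1.val) ⟨⟨0, hL⟩, Finset.mem_univ _⟩ |>.imp fun p hp => fun q => hp.2 q (Finset.mem_univ _)
    apply le_antisymm
    · have := Finset.le_sup (f := fun q : Fin L => (τ q).1.val + 1) (Finset.mem_univ p)
      have h3 : (Finset.univ.sup fun q : Fin L => (τ q).1.val) ≤ (τ p).1.val := Finset.sup_le fun q _ => hp q
      omega
    · exact Finset.sup_le fun q _ => Nat.succ_le_succ (Finset.le_sup (f := fun q : Fin L => (τ q).1.val) (Finset.mem_univ q))

end rawgrowth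


/-! ### The pruned depth-first census: definitions

The search carries a STATE `s : S` summarising the prefix (for the step censuses: the trail of lattice points visited), updated
letter by letter by `upd`, started at `s₀`; `ok s` is the pruning test (a prefix whose state fails it has no admissible completion
and is not explored), `cls c s` the test of class `c` at full length.  `dfsV … j s m`: from a prefix with state `s` and `m` axes,
append `j` more letters of axis `≤ m` (restricted growth: only canonical words are formed) and add `B^(N·c + m')` at every full word of
class `c < C` with `m'` axes.  One natural number thus carries the whole table (class × number of axes) in base `B` with stride `N`;
`dfsN … c k` is the scalar count it encodes. -/

section dfs

variable {S : Type*} (alw : ℕ → ℕ × Bool → Bool) (upd : S → ℕ × Bool → S) (ok : S → Bool) (cls : ℕ → S → Bool)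

/-- The letters generated while the axis count is `m`: axis `≤ m`, filtered by the policy. [cite: MadrasSlade1993, Definition 1.2.4] -/
def lts (m : ℕ) : List (ℕ × Bool) := (letters (m + 1)).filter (alw m)

/-- The state of a raw prefix: the letters folded into the start state. [cite: MadrasSlade1993, Definition 1.2.4] -/
def st (s₀ : S) (w : List (ℕ × Bool)) : S := w.foldl upd s₀

/-- The state after one more letter. [cite: MadrasSlade1993, Definition 1.2.4] -/
theorem st_append_singleton (s₀ : S) (w : List (ℕ × Bool)) (a : ℕ × Bool) : st upd s₀ (w ++ [a]) = upd (st upd s₀ w) a := by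
  simp [st]

/-- The leaf value: `Σ_{c < C, cls c s} B^(N c + m)`. [cite: MadrasSlade1993, Definition 1.2.4] -/
def leafV (C N B : ℕ) (s : S) (m : ℕ) : ℕ :=
  (List.range C).foldr (fun c acc => acc + if cls c s then B ^ (N * c + m) else 0) 0

/-- ★ The pruned depth-first census, base-`B` encoded (what the kernel evaluates). [cite: MadrasSlade1993, Definition 1.2.4] -/
def dfsV (C N B : ℕ) : ℕ → S → ℕ → ℕ
  | 0, s, m => if ok s then leafV cls C N B s m else 0
  | j + 1, s, m => if ok s then (lts alw m).foldr (fun a acc => acc + dfsV C N B j (upd s a) (nxt m a)) 0 else 0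

/-- The scalar count of class `c` with final axis count `k` (the digit the census encodes). [cite: MadrasSlade1993, Definition 1.2.4] -/
def dfsN (c k : ℕ) : ℕ → S → ℕ → ℕ
  | 0, s, m => if ok s then (if cls c s = true ∧ m = k then 1 else 0) else 0
  | j + 1, s, m => if ok s then (lts alw m).foldr (fun a acc => acc + dfsN c k j (upd s a) (nxt m a)) 0 else 0

/-- The letters of `letters n` have axis `< n`. [cite: MadrasSlade1993, Definition 1.2.4] -/
theorem mem_letters {n : ℕ} {a : ℕ × Bool} (h : a ∈ letters n) : a.1 < n := by
  unfold letters at h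
  simp only [List.mem_flatMap, List.mem_range, List.mem_cons, List.not_mem_nil, or_false] at h
  obtain ⟨x, hx, rfl | rfl⟩ := h <;> exact hx

/-- `letters n` has `2n` elements. [cite: MadrasSlade1993, Definition 1.2.4] -/
theorem length_letters (n : ℕ) : (letters n).length = 2 * n := by
  unfold letters
  induction n with
  | zero => rfl
  | succ n ih => rw [List.range_succ, List.flatMap_append, List.length_append, ih]; simp; ring

/-- The generated letters have axis `≤ m` and pass the policy. [cite: MadrasSlade1993, Definition 1.2.4] -/
theorem mem_lts {m : ℕ} {a : ℕ × Bool} (h : a ∈ lts alw m) : a.1 < m + 1 ∧ alw m a = true := by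
  unfold lts at h
  rw [List.mem_filter] at h
  exact ⟨mem_letters h.1, h.2⟩

/-- At most `2(m+1)` letters are generated. [cite: MadrasSlade1993, Definition 1.2.4] -/
theorem length_lts_le (m : ℕ) : (lts alw m).length ≤ 2 * (m + 1) := by
  unfold lts
  rw [← length_letters (m + 1)]
  exact List.length_filter_le _ _

/-- After a letter of axis `≤ m` the count is at most `m + 1`. [cite: MadrasSlade1993, Definition 1.2.4] -/
theorem nxt_le {m : ℕ} {a : ℕ × Bool} (h : a.1 < m + 1) : nxt m a ≤ m + 1 := max_le (Nat.le_succ m) h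

/-- A fold-sum is bounded by length × bound. [cite: MadrasSlade1993, Definition 1.2.4] -/
theorem foldr_add_le {α : Type*} (l : List α) (f : α → ℕ) (M : ℕ) (h : ∀ a ∈ l, f a ≤ M) :
    l.foldr (fun a acc => acc + f a) 0 ≤ l.length * M := by
  induction l with
  | nil => simp
  | cons a l ih =>
    rw [List.foldr_cons, List.length_cons, Nat.succ_mul]
    have h1 := h a (by simp)
    have h2 := ih fun b hb => h b (by simp [hb])
    omega

/-- ★ A-PRIORI BOUND on the digits: `dfsN c k j s m ≤ (2(m + j))^j` — at most `2(m+1) ≤ 2(m+j)` letters per level. [cite: MadrasSlade1993, Definition 1.2.4] -/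
theorem dfsN_le (c k : ℕ) : ∀ (j : ℕ) (s : S) (m : ℕ), dfsN alw upd ok cls c k j s m ≤ (2 * (m + j)) ^ j := by
  intro j
  induction j with
  | zero => intro s m; unfold dfsN; split_ifs <;> simp
  | succ j ih =>
    intro s m
    unfold dfsN
    split_ifs
    · refine le_trans (foldr_add_le _ _ ((2 * (m + (j + 1))) ^ j) fun a ha => ?_) ?_
      · refine le_trans (ih _ _) (Nat.pow_le_pow_left ?_ _)
        have := nxt_le (mem_lts alw ha).1
        omega
      · rw [pow_succ']
        exact le_trans (Nat.mul_le_mul_right _ (length_lts_le alw m)) (Nat.mul_le_mul_right _ (by omega))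
    · exact Nat.zero_le _

/-- The row value of class `c`: its digits `dfsN c k`, `k ≤ L`, in base `B`. [cite: MadrasSlade1993, Definition 1.2.4] -/
def rowV (L B c j : ℕ) (s : S) (m : ℕ) : ℕ := ∑ k ∈ Finset.range (L + 1), dfsN alw upd ok cls c k j s m * B ^ k

/-- Distributing a fold-sum. [cite: MadrasSlade1993, Definition 1.2.4] -/
theorem foldr_add_finset_sum {α : Type*} (l : List α) (t : Finset ℕ) (f : ℕ → α → ℕ) :
    l.foldr (fun a acc => acc + ∑ i ∈ t, f i a) 0 = ∑ i ∈ t, l.foldr (fun a acc => acc + f i a) 0 := by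
  induction l with
  | nil => simp
  | cons a l ih => rw [List.foldr_cons, ih, ← Finset.sum_add_distrib]; rfl

/-- Scaling a fold-sum. [cite: MadrasSlade1993, Definition 1.2.4] -/
theorem foldr_add_mul {α : Type*} (l : List α) (f : α → ℕ) (x : ℕ) :
    l.foldr (fun a acc => acc + f a * x) 0 = l.foldr (fun a acc => acc + f a) 0 * x := by
  induction l with
  | nil => simp
  | cons a l ih => rw [List.foldr_cons, List.foldr_cons, ih, Nat.add_mul]

/-- The leaf value in table form (for `m ≤ L`). [cite: MadrasSlade1993, Definition 1.2.4] -/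
theorem leafV_eq (C L B : ℕ) (s : S) {m : ℕ} (hm : m ≤ L) :
    leafV cls C (L + 1) B s m =
      ∑ c ∈ Finset.range C, (∑ k ∈ Finset.range (L + 1), (if cls c s = true ∧ m = k then 1 else 0) * B ^ k) * (B ^ (L + 1)) ^ c := by
  have hrow : ∀ c, ∑ k ∈ Finset.range (L + 1), (if cls c s = true ∧ m = k then 1 else 0) * B ^ k = if cls c s = true then B ^ m else 0 := by
    intro c
    rw [Finset.sum_eq_single_of_mem m (Finset.mem_range.2 (Nat.lt_succ_of_le hm))]
    · by_cases h : cls c s = true <;> simp [h]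
    · intro k _ hk
      rw [if_neg fun h => hk h.2.symm, zero_mul]
  simp only [hrow]
  unfold leafV
  rw [foldr_add_eq_sum, ← List.sum_toFinset _ (List.nodup_range), List.toFinset_range]
  refine Finset.sum_congr rfl fun c _ => ?_
  by_cases h : cls c s = true
  · rw [if_pos h, if_pos h, ← pow_mul, ← pow_add, Nat.add_comm, Nat.mul_comm]
  · rw [if_neg h, if_neg h, zero_mul]

/-- ★ THE ENCODING IDENTITY: the census value is the table of scalar counts, rows in base `B^(L+1)`, digits in base `B`
(valid while `m + j ≤ L`, which the recursion maintains). [cite: MadrasSlade1993, Definition 1.2.4] -/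
theorem dfsV_eq (C L B : ℕ) : ∀ (j : ℕ) (s : S) (m : ℕ), m + j ≤ L →
    dfsV alw upd ok cls C (L + 1) B j s m = ∑ c ∈ Finset.range C, rowV alw upd ok cls L B c j s m * (B ^ (L + 1)) ^ c := by
  intro j
  induction j with
  | zero =>
    intro s m hm
    unfold dfsV rowV dfsN
    by_cases hok : ok s = true
    · simp only [hok, if_true]
      exact leafV_eq cls C L B s (by simpa using hm)
    · simp [hok]
  | succ j ih =>
    intro s m hm
    unfold dfsV rowV
    by_cases hok : ok s = true
    · simp only [hok, if_true]
      -- rewrite every branch by the induction hypothesis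
      have hbranch : ∀ a ∈ lts alw m, dfsV alw upd ok cls C (L + 1) B j (upd s a) (nxt m a) =
          ∑ c ∈ Finset.range C, (∑ k ∈ Finset.range (L + 1), dfsN alw upd ok cls c k j (upd s a) (nxt m a) * B ^ k) * (B ^ (L + 1)) ^ c := by
        intro a ha
        have : nxt m a + j ≤ L := by have := nxt_le (mem_lts alw ha).1; omega
        rw [ih _ _ this]
        rfl
      rw [foldr_add_congr _ _ _ hbranch, foldr_add_finset_sum]
      refine Finset.sum_congr rfl fun c _ => ?_
      rw [foldr_add_mul, foldr_add_finset_sum]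
      simp only [dfsN, hok, if_true]
      congr 1
      refine Finset.sum_congr rfl fun k _ => ?_
      rw [foldr_add_mul]
    · simp only [hok]
      rw [eq_comm]
      refine Finset.sum_eq_zero fun c _ => ?_
      rw [Finset.sum_eq_zero fun k _ => ?_, zero_mul]
      rw [dfsN, if_neg hok, zero_mul]

/-! ### Reading the digits off the census value -/

/-- `Σ_{i < n} f i · X^i` is `Nat.ofDigits X` of the list of the `f i`. [cite: MadrasSlade1993, Definition 1.2.4] -/
theorem sum_mul_pow_eq_ofDigits (f : ℕ → ℕ) (X n : ℕ) :
    ∑ i ∈ Finset.range n, f i * X ^ i = Nat.ofDigits X ((List.range n).map f) := by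
  induction n with
  | zero => simp
  | succ n ih =>
    rw [Finset.sum_range_succ, ih, List.range_succ, List.map_append, List.map_singleton, Nat.ofDigits_append,
      Nat.ofDigits_singleton, List.length_map, List.length_range, mul_comm (f n)]

/-- Base-`b` digit lists of equal length are determined by their value. [cite: MadrasSlade1993, Definition 1.2.4] -/
theorem ofDigits_inj_of_length_eq {b : ℕ} : ∀ (l₁ l₂ : List ℕ), l₁.length = l₂.length → (∀ x ∈ l₁, x < b) → (∀ x ∈ l₂, x < b) →
    Nat.ofDigits b l₁ = Nat.ofDigits b l₂ → l₁ = l₂ := by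
  intro l₁
  induction l₁ with
  | nil => intro l₂ h _ _ _; cases l₂ with | nil => rfl | cons _ _ => simp at h
  | cons d l ih =>
    intro l₂ hlen h1 h2 heq
    cases l₂ with
    | nil => simp at hlen
    | cons d' l' =>
      rw [Nat.ofDigits_cons, Nat.ofDigits_cons] at heq
      have hd : d < b := h1 d (by simp)
      have hd' : d' < b := h2 d' (by simp)
      have hmod := congrArg (· % b) heq
      simp only [Nat.add_mul_mod_self_left, Nat.mod_eq_of_lt hd, Nat.mod_eq_of_lt hd'] at hmod
      subst hmod
      have hb : 0 < b := lt_of_le_of_lt (Nat.zero_le _) hd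
      have htl : Nat.ofDigits b l = Nat.ofDigits b l' := Nat.eq_of_mul_eq_mul_left hb (by omega)
      rw [ih l' (by simpa using hlen) (fun x hx => h1 x (by simp [hx])) (fun x hx => h2 x (by simp [hx])) htl]

/-- A base-`b` digit list of length `n` has value `< b^n`. [cite: MadrasSlade1993, Definition 1.2.4] -/
theorem ofDigits_lt_pow_length {b : ℕ} : ∀ (l : List ℕ), (∀ x ∈ l, x < b) → Nat.ofDigits b l < b ^ l.length := by
  intro l
  induction l with
  | nil => intro; simp [Nat.ofDigits]
  | cons d l ih =>
    intro h
    rw [Nat.ofDigits_cons, List.length_cons, pow_succ]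
    have hd : d < b := h d (by simp)
    have ht := ih fun x hx => h x (by simp [hx])
    have hb : 0 < b := lt_of_le_of_lt (Nat.zero_le _) hd
    calc d + b * Nat.ofDigits b l < b + b * Nat.ofDigits b l := by omega
      _ = b * (Nat.ofDigits b l + 1) := by ring
      _ ≤ b * b ^ l.length := Nat.mul_le_mul_left _ ht
      _ = b ^ l.length * b := mul_comm _ _

/-- ★ THE DIGITS OF THE CENSUS: if the full census `dfsV … C (L+1) B L s₀ 0` has the value `Nat.ofDigits (B^(L+1)) (rows of ns)` for a
table `ns` of `C` rows of `L+1` entries `< B`, and `B > (2L)^L`, then every scalar count `dfsN … c k L s₀ 0` IS the table entry.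
[cite: MadrasSlade1993, Definition 1.2.4] -/
theorem dfsN_eq_of_table {C L B : ℕ} (s₀ : S) (hB : (2 * L) ^ L < B) (ns : List (List ℕ)) (hC : ns.length = C)
    (hlen : ∀ r ∈ ns, r.length = L + 1) (hlt : ∀ r ∈ ns, ∀ x ∈ r, x < B)
    (hV : dfsV alw upd ok cls C (L + 1) B L s₀ 0 = Nat.ofDigits (B ^ (L + 1)) (ns.map (Nat.ofDigits B)))
    {c k : ℕ} (hc : c < C) (hk : k ≤ L) : dfsN alw upd ok cls c k L s₀ 0 = (ns.getD c []).getD k 0 := by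
  -- the computed rows
  set rows : List (List ℕ) := (List.range C).map fun c => (List.range (L + 1)).map fun k => dfsN alw upd ok cls c k L s₀ 0 with hrows
  have hdig : ∀ c' k', dfsN alw upd ok cls c' k' L s₀ 0 < B := fun c' k' =>
    lt_of_le_of_lt (by simpa using dfsN_le alw upd ok cls c' k' L s₀ 0) hB
  have hrowlt : ∀ r ∈ rows, Nat.ofDigits B r < B ^ (L + 1) := by
    intro r hr
    obtain ⟨c', -, rfl⟩ := List.mem_map.1 hr
    have := ofDigits_lt_pow_length (b := B) ((List.range (L + 1)).map fun k => dfsN alw upd ok cls c' k L s₀ 0)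
      (fun x hx => by obtain ⟨k', -, rfl⟩ := List.mem_map.1 hx; exact hdig _ _)
    simpa using this
  have hval : dfsV alw upd ok cls C (L + 1) B L s₀ 0 = Nat.ofDigits (B ^ (L + 1)) (rows.map (Nat.ofDigits B)) := by
    rw [dfsV_eq alw upd ok cls C L B L s₀ 0 (by simp), hrows, List.map_map, ← sum_mul_pow_eq_ofDigits]
    refine Finset.sum_congr rfl fun c' _ => ?_
    unfold rowV
    rw [sum_mul_pow_eq_ofDigits]
    rfl
  -- outer digits agree
  have houter : rows.map (Nat.ofDigits B) = ns.map (Nat.ofDigits B) := by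
    refine ofDigits_inj_of_length_eq _ _ (by simp [hrows, hC]) ?_ ?_ (hval.symm.trans hV)
    · intro x hx
      obtain ⟨r, hr, rfl⟩ := List.mem_map.1 hx
      exact hrowlt r hr
    · intro x hx
      obtain ⟨r, hr, rfl⟩ := List.mem_map.1 hx
      have := ofDigits_lt_pow_length r (hlt r hr)
      rwa [hlen r hr] at this
  -- row `c` agrees
  have hcR : c < rows.length := by simp [hrows, hc]
  have hcN : c < ns.length := by rw [hC]; exact hc
  have hrowc : Nat.ofDigits B (rows[c]'hcR) = Nat.ofDigits B (ns[c]'hcN) := by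
    have := congrArg (fun l => l[c]?) houter
    simp only [List.getElem?_map, List.getElem?_eq_getElem hcR, List.getElem?_eq_getElem hcN, Option.map_some] at this
    exact Option.some.inj this
  have hrc : rows[c]'hcR = (List.range (L + 1)).map fun k => dfsN alw upd ok cls c k L s₀ 0 := by simp [hrows]
  have heqrow : rows[c]'hcR = ns[c]'hcN := by
    refine ofDigits_inj_of_length_eq _ _ ?_ ?_ (hlt _ (List.getElem_mem hcN)) hrowc
    · rw [hrc, hlen _ (List.getElem_mem hcN)]; simp
    · rw [hrc]; intro x hx; obtain ⟨k', -, rfl⟩ := List.mem_map.1 hx; exact hdig _ _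
  have hget : (ns.getD c []) = rows[c]'hcR := by
    rw [heqrow, List.getD_eq_getElem?_getD, List.getElem?_eq_getElem hcN, Option.getD_some]
  rw [hget, hrc, List.getD_eq_getElem?_getD, List.getElem?_map, List.getElem?_range (Nat.lt_succ_of_le hk)]
  rfl

end dfs

/-! ### The census theorem: the scalar counts ARE the class counts over canonical words -/

section census

variable {S : Type*} (alw : ℕ → ℕ × Bool → Bool) (upd : S → ℕ × Bool → S) (ok : S → Bool) (cls : ℕ → S → Bool) (s₀ : S)

/-- The raw word of a prefix `w` completed by the letters `v`. [cite: MadrasSlade1993, Definition 1.2.4] -/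
def xw {L j : ℕ} (w : List (ℕ × Bool)) (v : Fin j → Idx L) : List (ℕ × Bool) := w ++ List.ofFn fun i => raw (v i)

/-- Admissible completions of the raw prefix `w` (restricted growth; the state of every prefix at least as long as `w` passes `ok`;
class `c`; `k` axes). [cite: MadrasSlade1993, Definition 1.2.4] -/
abbrev Adm (L c k : ℕ) (w : List (ℕ × Bool)) {j : ℕ} (v : Fin j → Idx L) : Prop :=
  rgA alw 0 (xw w v) = true ∧ (∀ i : Fin (L + 1), w.length ≤ i.val → ok (st upd s₀ ((xw w v).take i.val)) = true) ∧
    cls c (st upd s₀ (xw w v)) = true ∧ naxL 0 (xw w v) = k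

/-- Sum of a `flatMap` of two-element lists. [cite: MadrasSlade1993, Definition 1.2.4] -/
theorem sum_map_letters (f : ℕ × Bool → ℕ) (n : ℕ) :
    ((letters n).map f).sum = ∑ i ∈ Finset.range n, (f (i, true) + f (i, false)) := by
  unfold letters
  induction n with
  | zero => simp
  | succ n ih =>
    rw [List.range_succ, List.flatMap_append, List.map_append, List.sum_append, ih, Finset.sum_range_succ]
    simp

/-- ★ Summing over the letters of `Idx L` with axis `≤ m` = folding over the raw letters `letters (m+1)` (for `m + 1 ≤ L`).
[cite: MadrasSlade1993, Definition 1.2.4] -/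
theorem sum_idx_eq_foldr_letters {L m : ℕ} (hmL : m + 1 ≤ L) (f : ℕ × Bool → ℕ) :
    ∑ a : Idx L, (if a.1.val ≤ m then f (raw a) else 0) = (letters (m + 1)).foldr (fun r acc => acc + f r) 0 := by
  rw [foldr_add_eq_sum, sum_map_letters, Fintype.sum_prod_type]
  simp only [Fintype.sum_bool, raw]
  have h1 : ∀ x : Fin L, ((if x.val ≤ m then f (x.val, true) else 0) + if x.val ≤ m then f (x.val, false) else 0) =
      if x.val ≤ m then f (x.val, true) + f (x.val, false) else 0 := by
    intro x; split_ifs <;> simp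
  simp only [h1]
  rw [Fin.sum_univ_eq_sum_range (fun i => if i ≤ m then f (i, true) + f (i, false) else 0) L, ← Finset.sum_filter]
  congr 1
  ext i
  simp only [Finset.mem_filter, Finset.mem_range]
  omega

/-- Folding over a filtered list = folding the indicator. [cite: MadrasSlade1993, Definition 1.2.4] -/
theorem foldr_add_filter {α : Type*} (l : List α) (p : α → Bool) (f : α → ℕ) :
    (l.filter p).foldr (fun a acc => acc + f a) 0 = l.foldr (fun a acc => acc + if p a = true then f a else 0) 0 := by
  induction l with
  | nil => rfl
  | cons a l ih =>
    rw [List.filter_cons]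
    by_cases h : p a = true
    · rw [if_pos h, List.foldr_cons, List.foldr_cons, if_pos h, ih]
    · rw [if_neg h, List.foldr_cons, if_neg h, Nat.add_zero, ih]

/-- ★ Summing over the letters of `Idx L` with axis `≤ m` allowed by the policy = folding over `lts alw m` (for `m + 1 ≤ L`).
[cite: MadrasSlade1993, Definition 1.2.4] -/
theorem sum_idx_eq_foldr_lts {L m : ℕ} (hmL : m + 1 ≤ L) (f : ℕ × Bool → ℕ) :
    ∑ a : Idx L, (if a.1.val ≤ m ∧ alw m (raw a) = true then f (raw a) else 0) = (lts alw m).foldr (fun r acc => acc + f r) 0 := by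
  unfold lts
  rw [foldr_add_filter, ← sum_idx_eq_foldr_letters hmL]
  refine Finset.sum_congr rfl fun a _ => ?_
  by_cases h1 : a.1.val ≤ m
  · by_cases h2 : alw m (raw a) = true
    · rw [if_pos ⟨h1, h2⟩, if_pos h1, if_pos h2]
    · rw [if_neg fun h => h2 h.2, if_pos h1, if_neg h2]
  · rw [if_neg fun h => h1 h.1, if_neg h1]

/-- `xw` after splitting off the first completing letter. [cite: MadrasSlade1993, Definition 1.2.4] -/
theorem xw_cons {L j : ℕ} (w : List (ℕ × Bool)) (a : Idx L) (v : Fin j → Idx L) :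
    xw w (Fin.cons a v : Fin (j + 1) → Idx L) = xw (w ++ [raw a]) v := by
  unfold xw
  rw [List.ofFn_succ, Fin.cons_zero, List.append_assoc, List.singleton_append]
  simp only [Fin.cons_succ]

/-- `xw` with no completing letter. [cite: MadrasSlade1993, Definition 1.2.4] -/
theorem xw_zero {L : ℕ} (w : List (ℕ × Bool)) (v : Fin 0 → Idx L) : xw w v = w := by
  unfold xw; simp

/-- Counting tuples of length `j+1` by their first entry. [cite: MadrasSlade1993, Definition 1.2.4] -/
theorem card_filter_fin_succ {X : Type*} [Fintype X] [DecidableEq X] {j : ℕ} (P : (Fin (j + 1) → X) → Prop) [DecidablePred P] :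
    (Finset.univ.filter P).card = ∑ a : X, (Finset.univ.filter fun v : Fin j → X => P (Fin.cons a v)).card := by
  rw [card_filter_univ_equiv (Fin.consEquiv fun _ : Fin (j + 1) => X) P, Finset.card_filter, Fintype.sum_prod_type]
  refine Finset.sum_congr rfl fun a _ => ?_
  rw [Finset.card_filter]
  rfl

/-- A prefix of `xw w v` no longer than `w` is a prefix of `w`. [cite: MadrasSlade1993, Definition 1.2.4] -/
theorem xw_take_of_le {L j : ℕ} (w : List (ℕ × Bool)) (v : Fin j → Idx L) {i : ℕ} (hi : i ≤ w.length) :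
    (xw w v).take i = w.take i := by
  unfold xw
  rw [List.take_append_of_le_length hi]

/-- ★★ THE COUNTING THEOREM: from a restricted-growth prefix `w` with `|w| + j = L`, the scalar DFS count
`dfsN … c k j (st w) (naxL 0 w)` is the number of admissible completions. [cite: MadrasSlade1993, Definition 1.2.4] -/
theorem dfsN_eq_card (L c k : ℕ) : ∀ (j : ℕ) (w : List (ℕ × Bool)), rgA alw 0 w = true → w.length + j = L →
    dfsN alw upd ok cls c k j (st upd s₀ w) (naxL 0 w) =
      (Finset.univ.filter fun v : Fin j → Idx L => Adm alw upd ok cls s₀ L c k w v).card := by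
  intro j
  induction j with
  | zero =>
    intro w hw hj
    rw [Finset.card_eq_sum_ones, Finset.sum_filter, Fintype.sum_unique]
    unfold dfsN Adm
    simp only [xw_zero]
    by_cases hok : ok (st upd s₀ w) = true
    · rw [if_pos hok]
      refine if_congr ⟨fun h => ⟨hw, fun i hi => ?_, h.1, h.2⟩, fun h => ⟨h.2.2.1, h.2.2.2⟩⟩ rfl rfl
      have : i.val = w.length := by have := i.isLt; omega
      rw [this, List.take_length]
      exact hok
    · rw [if_neg hok, if_neg]
      rintro ⟨-, h, -⟩
      have := h ⟨w.length, by omega⟩ le_rfl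
      rw [List.take_length] at this
      exact hok this
  | succ j ih =>
    intro w hw hj
    -- split off the first completing letter
    rw [card_filter_fin_succ]
    by_cases hok : ok (st upd s₀ w) = true
    · -- the inner counts are the counts of the extended prefixes, or zero
      have hinner : ∀ a : Idx L,
          (Finset.univ.filter fun v : Fin j → Idx L => Adm alw upd ok cls s₀ L c k w (Fin.cons a v : Fin (j + 1) → Idx L)).card =
          if a.1.val ≤ naxL 0 w ∧ alw (naxL 0 w) (raw a) = true then
            dfsN alw upd ok cls c k j (st upd s₀ (w ++ [raw a])) (nxt (naxL 0 w) (raw a)) else 0 := by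
        intro a
        by_cases ha : a.1.val ≤ naxL 0 w ∧ alw (naxL 0 w) (raw a) = true
        · rw [if_pos ha]
          have hw' : rgA alw 0 (w ++ [raw a]) = true := by
            rw [rgA_append_singleton, hw, Bool.true_and, Bool.and_eq_true, Nat.ble_eq]; exact ha
          rw [← naxL_append_singleton, ih (w ++ [raw a]) hw' (by simp; omega)]
          refine congrArg Finset.card (Finset.filter_congr fun v _ => ?_)
          unfold Adm
          rw [xw_cons]
          refine ⟨fun h => ⟨h.1, fun i hi => h.2.1 i ?_, h.2.2⟩, fun h => ⟨h.1, fun i hi => ?_, h.2.2⟩⟩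
          · simp only [List.length_append, List.length_singleton] at hi; omega
          · rcases Nat.eq_or_lt_of_le hi with hi' | hi'
            · -- the prefix `w` itself
              rw [← hi', xw_take_of_le _ _ (by simp), List.take_left]
              exact hok
            · exact h.2.1 i (by simp; omega)
        · rw [if_neg ha, Finset.card_eq_zero, Finset.filter_eq_empty_iff]
          intro v _ h
          apply ha
          unfold Adm at h
          rw [xw_cons] at h
          have h1 := h.1
          unfold xw at h1
          rw [rgA_append, rgA_append_singleton, Bool.and_eq_true, Bool.and_eq_true, Bool.and_eq_true, Nat.ble_eq] at h1
          exact h1.1.2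
      simp only [hinner]
      have hmL : naxL 0 w + 1 ≤ L := by
        have := naxL_le 0 w (rgOK_of_rgA alw 0 w hw); simp only [Nat.zero_add] at this; omega
      have e := sum_idx_eq_foldr_lts alw hmL (fun r => dfsN alw upd ok cls c k j (st upd s₀ (w ++ [r])) (nxt (naxL 0 w) r))
      beta_reduce at e
      rw [e, dfsN, if_pos hok]
      simp only [st_append_singleton]
    · -- a pruned prefix has no admissible completion
      rw [dfsN, if_neg hok, eq_comm]
      refine Finset.sum_eq_zero fun a _ => ?_
      rw [Finset.card_eq_zero, Finset.filter_eq_empty_iff]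
      intro v _ h
      apply hok
      have := h.2.1 ⟨w.length, by omega⟩ le_rfl
      rwa [xw_take_of_le _ _ le_rfl, List.take_length] at this

/-! ### The transversal of length `L` and the census in every dimension -/

variable {L : ℕ}

/-- The transversal of length `L`: the canonical words. [cite: MadrasSlade1993, Definition 1.2.4] -/
def TL (L : ℕ) : Finset (Word L L) := Finset.univ.filter fun τ => canon τ = τ

/-- Every word of `TL L` is canonical. [cite: MadrasSlade1993, Definition 1.2.4] -/
theorem canon_TL : ∀ τ ∈ TL L, canon τ = τ := fun _ hτ => (Finset.mem_filter.1 hτ).2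

/-- ★ COMPLETENESS: the canonical representative of every word lies in `TL L`. [cite: MadrasSlade1993, Definition 1.2.4] -/
theorem canon_mem_TL {d : ℕ} (u : Word L d) : canon u ∈ TL L :=
  Finset.mem_filter.2 ⟨Finset.mem_univ _, (growthOK_iff_canon_eq _).1 (axFixed_canon u).growthOK⟩

/-- ★ The classes of `TL L` exhaust `Word L d`: total size `(2d)^L`. [cite: MadrasSlade1993, Definition 1.2.4] -/
theorem count_TL (d : ℕ) : ∑ τ ∈ TL L, d.descFactorial (numAxes τ) = (2 * d) ^ L := by
  classical
  have hdisj : (TL L : Set (Word L L)).PairwiseDisjoint fun τ => Finset.univ.filter fun u : Word L d => SameType u τ := by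
    intro τ hτ τ' hτ' hne
    refine Finset.disjoint_left.2 fun u hu hu' => hne ?_
    have h1 : SameType u τ := (Finset.mem_filter.1 hu).2
    have h2 : SameType u τ' := (Finset.mem_filter.1 hu').2
    rw [← canon_TL τ hτ, ← canon_TL τ' hτ']
    exact (h1.symm.trans h2).canon_eq
  have hunion : (TL L).biUnion (fun τ => Finset.univ.filter fun u : Word L d => SameType u τ) = Finset.univ := by
    apply Finset.eq_univ_of_forall
    intro u
    rw [Finset.mem_biUnion]
    exact ⟨canon u, canon_mem_TL u, Finset.mem_filter.2 ⟨Finset.mem_univ _, sameType_canon u⟩⟩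
  have := congrArg Finset.card hunion
  rw [Finset.card_biUnion hdisj, Finset.card_univ, card_word] at this
  rw [← this]
  exact Finset.sum_congr rfl fun τ _ => (card_filter_sameType τ d).symm

/-- ★ MASTER FORMULA AT LENGTH `L` over the transversal `TL L`. [cite: MadrasSlade1993, Definition 1.2.4] -/
theorem card_filter_eq_sum_TL {d : ℕ} (Q : Word L d → Prop) [DecidablePred Q] (Q₀ : Word L L → Prop) [DecidablePred Q₀]
    (hQ : ∀ u : Word L d, Q u ↔ Q₀ (canon u)) :
    (Finset.univ.filter Q).card = ∑ τ ∈ TL L, if Q₀ τ then d.descFactorial (numAxes τ) else 0 :=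
  card_filter_eq_sum_transversal (TL L) canon_TL (count_TL d) Q Q₀ hQ

/-- The state of every prefix of the raw word (the empty one included) passes the pruning test. [cite: MadrasSlade1993, Definition 1.2.4] -/
abbrev PrefixOK {n : ℕ} (τ : Word L n) : Prop := ∀ i : Fin (L + 1), ok (st upd s₀ ((rawW τ).take i.val)) = true

/-- ★★ THE CLASS COUNT OVER THE TRANSVERSAL IS THE SCALAR DFS COUNT: canonical words all of whose prefixes pass `ok`, in class `c`,
with `k` axes, number `dfsN … c k L s₀ 0`. [cite: MadrasSlade1993, Definition 1.2.4] -/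
theorem card_TL_class (c k : ℕ) :
    (((TL L).filter fun τ => rgA alw 0 (rawW τ) = true ∧ PrefixOK upd ok s₀ τ ∧ cls c (st upd s₀ (rawW τ)) = true).filter
      fun τ => numAxes τ = k).card = dfsN alw upd ok cls c k L s₀ 0 := by
  have h := dfsN_eq_card alw upd ok cls s₀ L c k L [] rfl (by simp)
  rw [naxL] at h
  change dfsN alw upd ok cls c k L s₀ 0 = _ at h
  rw [h, TL, Finset.filter_filter, Finset.filter_filter]
  refine congrArg Finset.card (Finset.filter_congr fun τ _ => ?_)
  have hx : xw [] τ = rawW τ := by unfold xw rawW; simp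
  unfold Adm
  rw [hx, ← growthOK_iff_canon_eq, growthOK_iff_rgOK]
  constructor
  · rintro ⟨hg, ⟨ha, hp, hc⟩, hk⟩
    exact ⟨ha, fun i _ => hp i, hc, by rw [← numAxes_eq_naxL τ ((growthOK_iff_rgOK τ).2 hg).axFixed]; exact hk⟩
  · rintro ⟨ha, hp, hc, hk⟩
    have hg := rgOK_of_rgA alw 0 _ ha
    exact ⟨hg, ⟨ha, fun i => hp i (Nat.zero_le _), hc⟩, by rw [numAxes_eq_naxL τ ((growthOK_iff_rgOK τ).2 hg).axFixed]; exact hk⟩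

/-- ★★★ THE CENSUS OF A CLASS IN EVERY DIMENSION from the scalar DFS counts: if `Q` (on `Word L d`) is type-invariant with canonical
form «the state of every prefix passes `ok` and the class test `cls c` holds at the end», then
`#{u : Word L d | Q u} = Σ_{k ≤ L} n_k · d^{(k)}` with `n_k = dfsN … c k L s₀ 0`. [cite: MadrasSlade1993, Definition 1.2.4] -/
theorem card_eq_sum_dfsN {d : ℕ} (c : ℕ) (Q : Word L d → Prop) [DecidablePred Q]
    (hQ : ∀ u : Word L d, Q u ↔ PrefixOK upd ok s₀ (canon u) ∧ cls c (st upd s₀ (rawW (canon u))) = true) (n : ℕ → ℕ)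
    (hn : ∀ k, k ≤ L → dfsN alwAll upd ok cls c k L s₀ 0 = n k) :
    (Finset.univ.filter Q).card = ∑ k ∈ Finset.range (L + 1), n k * d.descFactorial k := by
  rw [card_filter_eq_sum_TL Q (fun τ => PrefixOK upd ok s₀ τ ∧ cls c (st upd s₀ (rawW τ)) = true) hQ, sum_ite_descFactorial_numAxes]
  refine Finset.sum_congr rfl fun k hk => ?_
  rw [← hn k (Nat.le_of_lt_succ (Finset.mem_range.1 hk)), ← card_TL_class alwAll upd ok cls s₀ c k, Finset.filter_filter,
    Finset.filter_filter]
  congr 1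
  refine congrArg Finset.card (Finset.filter_congr fun τ hτ => ?_)
  have : rgA alwAll 0 (rawW τ) = true := by
    rw [rgA_alwAll, ← growthOK_iff_rgOK, growthOK_iff_canon_eq]; exact canon_TL τ hτ
  exact ⟨fun h => ⟨⟨this, h.1⟩, h.2⟩, fun h => ⟨h.1.2, h.2⟩⟩

end census


/-! ### The step-walk state for the pruned search: reversed raw prefix, backward displacements

For the censuses of self-avoiding step words the state is the raw prefix READ BACKWARDS (most recent letter first): `updR` conses the
new letter.  The pruning test `okR n` (for words over `n` axes) walks back from the endpoint accumulating the displacement (a list of `n`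
integers) and fails as soon as it vanishes — the endpoint of the prefix would be an earlier point; `unitR n j` says that the last `j`
letters sum to `±` a unit vector (the one-step extension closes a `(j+1)`-gon behind them).  The reduced letter policy `alwR` writes a
NEW axis with the positive sign only (first occurrences positive); `rgA alwR` is restricted growth with positive first occurrences. -/

section walkstate

/-- The sign of a raw letter as an integer. [cite: MadrasSlade1993, Definition 1.2.4] -/
def sgZ (b : Bool) : ℤ := if b then 1 else -1

/-- Add a raw letter to a displacement (coordinates indexed by axis). [cite: MadrasSlade1993, Definition 1.2.4] -/
def addD (D : List ℤ) (a : ℕ × Bool) : List ℤ := D.modify a.1 (· + sgZ a.2)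

/-- The displacement vanishes. [cite: MadrasSlade1993, Definition 1.2.4] -/
def isZ (D : List ℤ) : Bool := D.all (· == 0)

/-- Walking back along the reversed prefix from displacement `D`: some nonempty initial run of letters brings the displacement to zero.
[cite: MadrasSlade1993, Definition 1.2.4] -/
def retZ : List ℤ → List (ℕ × Bool) → Bool
  | _, [] => false
  | D, a :: rest =>
    let D' := addD D a
    isZ D' || retZ D' rest

/-- State update: the new letter in front (the state is the reversed raw prefix). [cite: MadrasSlade1993, Definition 1.2.4] -/
def updR (s : List (ℕ × Bool)) (a : ℕ × Bool) : List (ℕ × Bool) := a :: s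

/-- Pruning test over `n` axes: no nonempty tail of the prefix sums to zero (its endpoint is a new point). [cite: MadrasSlade1993, Definition 1.2.4] -/
def okR (n : ℕ) (s : List (ℕ × Bool)) : Bool := !(retZ (List.replicate n 0) s)

/-- The displacement of the last `j` letters (the first `j` of the reversed prefix), over `n` axes. [cite: MadrasSlade1993, Definition 1.2.4] -/
def sumD (n j : ℕ) (s : List (ℕ × Bool)) : List ℤ := (s.take j).foldl addD (List.replicate n 0)

/-- The displacement is `±` a unit vector: its coordinates have absolute values summing to one. [cite: MadrasSlade1993, Definition 1.2.4] -/
def isUnit (D : List ℤ) : Bool := (D.map Int.natAbs).sum == 1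

/-- Class test over `n` axes: the last `j` letters sum to `±` a unit vector. [cite: MadrasSlade1993, Definition 1.2.4] -/
def unitR (n j : ℕ) (s : List (ℕ × Bool)) : Bool := isUnit (sumD n j s)

/-- The four classes of the ten-step census at word length 8 (over 8 axes): all words; the last 3 / 5 / 7 letters sum to `±` a unit vector
(the ninth step can close a square / hexagon / octagon). [cite: MadrasSlade1993, §1.2] -/
def clsR8 : ℕ → List (ℕ × Bool) → Bool
  | 0 => fun _ => true
  | 1 => unitR 8 3
  | 2 => unitR 8 5
  | 3 => unitR 8 7
  | _ => fun _ => false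

/-- The reduced letter policy: a NEW axis (axis = running count) is written with the positive sign only. [cite: MadrasSlade1993, Definition 1.2.4] -/
def alwR : ℕ → ℕ × Bool → Bool := fun m a => !(a.1 == m) || a.2

/-- The table of the ten-step census cell: rows = classes (all / square / hexagon / octagon closer behind), columns = number of axes
`0, …, 8`; entries = canonical self-avoiding eight-letter words with positive first occurrences. [cite: MadrasSlade1993, Appendix C, Table C.1] -/
def tab8 : List (List ℕ) :=
  [[0, 1, 739, 7713, 11536, 4947, 786, 49, 1], [0, 0, 124, 1019, 1137, 342, 34, 1, 0], [0, 0, 39, 441, 404, 82, 4, 0, 0], [0, 0, 22, 238, 216, 27, 0, 0, 0]]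

set_option maxHeartbeats 800000 in
/-- ★ THE KERNEL CELL of the ten-step census: the pruned reduced search over the canonical self-avoiding eight-letter words with
positive first occurrences (25 772 of them), four classes × nine axis counts, base `2^33`, stride 9 — one natural number, stated as the
base-`2^33` encoding of `tab8` (budget: ≈ 100 s of kernel time). [cite: MadrasSlade1993, Appendix C, Table C.1] -/
theorem dfsV_eight_reduced :
    dfsV alwR updR (okR 8) clsR8 4 9 8589934592 8 [] 0 = Nat.ofDigits (8589934592 ^ 9) (tab8.map (Nat.ofDigits 8589934592)) := by
  decide +kernel

end walkstate

end WordTypes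

end Literature.Probability.RandomPlanarGeometry.SAW.Zd
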